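import Mathlib
import HarnessLib
import Summits.HubbardSuperconductivity.HubbardSuperconductivity.Theorems.KLProgrammeKLRegimeEngineTowerLevReadoutProfileF

/-!
# Route `KLProgramme` — crux K3 ENGINE (stmt-HubbardSuperconductivity-20437 `KLRegimeEngineV17F2`), stub (b) v2, THE LEVELS PACKAGE (ℓ), located item
# «(ℓ)-READOUT-F» piece RO-1 (continued): THE READ-OUT PROFILE AT ANY LEVEL `dk ≤ J′` — the first levels of block 1, where the base is jumped by fewer than
# `d − 1` families (cell gate-hubbard-kl, seat hubbard-kl-k3c3-p2 g16; companion of …TowerLevReadoutProfileF §5, which asks `2d − 2 ≤ J′`)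

`readoutLevF_le_profileR` (…TowerLevReadoutProfileF §5) recovers the law's input profile `(A′, Q′)` at the read-out family because both the base term and the
increments are jumped by at least `d − 1` families and earn the block gain `G = ((2^{d−1})⁻¹)^{e_F}`.  At the first levels of block `1` (`d ≤ J′ < 2d − 2`) the base
`𝒱_d` is jumped by `J′ − (d−1) < d − 1` families only; this file states the profile for EVERY `J′ ≥ dk` with the base term taken without gain:

* **`readoutLevF_le_profileR_anyJump`** — `27^{t+1}·klLevNormOf … J′ (2p) 𝒱_{dk} Ωe / klLevUnitF … t p J′ ≤
  27⁵(C₁/C₂)·(A_b + 8^{d−1}·A/(1−(2^d)⁻¹))·λ^{p−1}·(C₂²·max Q_b ((2^{d−1})⁻¹·max Q Q_b))^p` (`2 ≤ d`, `1 ≤ k`, `dk ≤ J′ ≤ n_β + 1`, `7 ≤ 2p + t`).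
The read-out fit (…TowerLevReadoutFit `towerReadout_le_of_ro`) takes any `(A_ro, Q_ro)`, so the levels `d ≤ j < 2d − 2` are closed with these constants in place
of §5's.  Compositions of landed theorems and real algebra; nothing about the model is asserted beyond them; nothing asserts (ℓ), any stub, K3 or superconductivity.
References: BGM 2006 §2.8 (2.83), (2.93)–(2.98) [cite: BenfattoGiulianiMastropietro2006].
-/

noncomputable section

namespace Summit.HubbardSuperconductivity.HubbardSuperconductivity.Theorems.EngineV8

set_option linter.dupNamespace false -- summit = problem name (single-conjunct summit), D-0017

open Classical
open Real Finset Literature.MathematicalPhysics.QuantumLattice Literature.Probability.LatticeModels GrassmannAlgebra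
open Literature.MathematicalPhysics.QuantumLattice.FermiRG
open Summit.HubbardSuperconductivity.HubbardSuperconductivity.Theorems.KLProgrammeLegKernels
open Summit.HubbardSuperconductivity.HubbardSuperconductivity.Theorems.KLRegimeSplit
open Summit.HubbardSuperconductivity.HubbardSuperconductivity.Theorems.KLRegimeWick
open Summit.HubbardSuperconductivity.HubbardSuperconductivity.Theorems.TorusFourierL2
open Summit.HubbardSuperconductivity.HubbardSuperconductivity.Theorems.DispersionFlow
open Summit.HubbardSuperconductivity.HubbardSuperconductivity.Theorems.PerturbedFermiCurve

variable {L M : ℕ} [NeZero L] [NeZero M]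

/-! ## The read-out profile without the long base jump (the first levels of block 1) -/

omit [NeZero L] [NeZero M] in
/-- **THE READ-OUT PROFILE FROM THE LAW, ANY READ-OUT LEVEL `dk ≤ J′`** (no `2d − 2 ≤ J′`: covers the first levels `d ≤ J′ < 2d − 2` of block `1`, where the base
`𝒱_d` is jumped by fewer than `d − 1` families and earns no block gain): under the binders of `readoutLevF_le_profileR` minus `2d − 2 ≤ J′`,
`27^{t+1}·klLevNormOf … J′ (2p) 𝒱_{dk} Ωe / klLevUnitF … t p J′ ≤ 27⁵(C₁/C₂)·(A_b + 8^{d−1}·A/(1 − (2^d)⁻¹))·λ^{p−1}·(C₂²·max Q_b ((2^{d−1})⁻¹·max Q Q_b))^p`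
(the base term is taken WITHOUT gain, the increments with the block gain as in §5). [cite: BenfattoGiulianiMastropietro2006, §2.8 (2.83), (2.93)-(2.98)] -/
theorem readoutLevF_le_profileR_anyJump :
    ∃ C₁ C₂ : ℝ, 0 < C₁ ∧ 0 < C₂ ∧ ∀ R : RenConsts, R.WF2 → ∃ c₃' : ℝ, 0 < c₃' ∧ ∃ U₀' : ℝ, 0 < U₀' ∧
      ∀ (P : SplitConsts) (c : ℝ), P.WF → 0 < c → c ≤ klEngC₃6 P R → c ≤ c₃' →
      ∀ μ ∈ klWindowC, ∀ U : ℝ, 0 < U → U ≤ klEngU₀9 P R c → U ≤ U₀' → ∀ β : ℝ, klBetaMin ≤ β → β ≤ Real.exp (c / U ^ 2) →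
      ∀ K : TrigPolyC4v, FrameOK R U (nScales β) μ K → ∀ (L M : ℕ) [NeZero L] [NeZero M],
      klEngL₃ β U ≤ L → klEngM₃ β U L ≤ M → ∀ d k J' : ℕ, 2 ≤ d → 1 ≤ k → d * k ≤ J' → J' ≤ nScales β + 1 → ∀ D : ℕ,
      ∀ (A lam Q Ab Qb : ℝ), 0 ≤ A → 0 ≤ lam → 0 ≤ Q → 0 ≤ Ab → 0 ≤ Qb →
      ∀ Nb : Fin 5 → ℕ → ℝ, (∀ t p, 0 ≤ Nb t p) →
        (∀ (t : Fin 5) (p : ℕ) (Ωe' : Fin (2 * p) → Option (SectorLeg (sectorCount (d - 1)))), levelCount Ωe' = (t : ℕ) + 1 →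
          klLevNormOf L M β μ K (d - 1) (2 * p) (klTowerInput L M β U μ K d 1) Ωe' ≤ Nb t p) →
        (∀ (t : Fin 5) (p : ℕ), 3 ≤ p → Nb t p / klLevUnitF β M t p (d - 1) ≤ Ab * lam ^ (p - 1) * Qb ^ p) →
        (∀ k' : ℕ, 2 ≤ k' → k' ≤ k → ∀ (t : Fin 5) (p : ℕ), 3 ≤ p → p ≤ D → klTowerBLevF L M β U μ K d t k' p ≤ A * lam ^ (p - 1) * Q ^ p) →
      ∀ (t : Fin 5) (p : ℕ), 3 ≤ p → p ≤ D → 7 ≤ 2 * p + (t : ℕ) →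
      ∀ Ωe : Fin (2 * p) → Option (SectorLeg (sectorCount J')), levelCount Ωe = (t : ℕ) + 1 →
        (27 : ℝ) ^ ((t : ℕ) + 1) * klLevNormOf L M β μ K J' (2 * p) (klTowerInput L M β U μ K d k) Ωe / klLevUnitF β M t p J' ≤
          (27 : ℝ) ^ 5 * (C₁ / C₂) * (Ab + (8 : ℝ) ^ (d - 1) * (A / (1 - ((2 : ℝ) ^ d)⁻¹))) * lam ^ (p - 1) *
            (C₂ ^ 2 * max Qb (((2 : ℝ) ^ (d - 1))⁻¹ * max Q Qb)) ^ p := by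
  obtain ⟨C₁, C₂, hC₁, hC₂, h⟩ := readoutLevF_le_kitSum
  refine ⟨C₁, C₂, hC₁, hC₂, fun R hR2 => ?_⟩
  obtain ⟨c₃, hc₃, U₀, hU₀, h'⟩ := h R hR2
  refine ⟨c₃, hc₃, U₀, hU₀, ?_⟩
  intro P c hP hc hc6 hc₃' μ hμ U hU hU9 hU₀' β hβmin hβc K hK L M _ _ hL3 hM3 d k J' hd hk1 hkJ hJN D A lam Q Ab Qb hA hlam hQ hAb hQb Nb hNb0 hcar
    hlawb hIH t p hp hpD hpt Ωe hlev
  have hβ : 0 < β := KLRegimeSplit.pos_of_klBetaMin_le hβmin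
  have ht4 : (t : ℕ) ≤ 4 := by have := t.isLt; omega
  have hg := klLevGain_le t
  have hg2 : 2 * klLevGain t ≤ (t : ℕ) := by
    unfold klLevGain levelGainExp
    have := t.isLt
    omega
  set ρ : ℝ := ((2 : ℝ) ^ d)⁻¹ with hρ
  have hsd1 : (1 : ℝ) < (2 : ℝ) ^ d := one_lt_pow₀ (by norm_num) (by omega)
  have hρ0 : 0 < ρ := by positivity
  have hρ1 : ρ < 1 := inv_lt_one_of_one_lt₀ hsd1
  have hρle : ρ ≤ 1 := hρ1.le
  have h1ρ : 0 < 1 - ρ := sub_pos.2 hρ1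
  set γ : ℝ := ((2 : ℝ) ^ (d - 1))⁻¹ with hγ
  have hγ0 : 0 ≤ γ := by positivity
  have hγ1 : γ ≤ 1 := inv_le_one_of_one_le₀ (one_le_pow₀ (by norm_num))
  set e : ℕ := p + (t : ℕ) - klLevGain t - 3 with he
  have he1 : 1 ≤ e := by omega
  set G : ℝ := γ ^ e with hG
  have hG0 : 0 ≤ G := by positivity
  have hGle : G ≤ (8 : ℝ) ^ (d - 1) * γ ^ p := by
    rw [hG]
    have h1 : γ ^ e ≤ γ ^ (p - 3) := pow_le_pow_of_le_one hγ0 hγ1 (by omega)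
    refine h1.trans (le_of_eq ?_)
    have h2 : (0 : ℝ) < (2 : ℝ) ^ (d - 1) := by positivity
    obtain ⟨q, rfl⟩ : ∃ q, p = q + 3 := ⟨p - 3, by omega⟩
    rw [Nat.add_sub_cancel, hγ, pow_add, inv_pow, inv_pow]
    have h8 : (8 : ℝ) ^ (d - 1) = ((2 : ℝ) ^ (d - 1)) ^ 3 := by
      rw [← pow_mul, mul_comm, pow_mul]; norm_num
    rw [h8]
    field_simp
  have hb : ((2 : ℝ) ^ e)⁻¹ ≤ 1 := inv_le_one_of_one_le₀ (one_le_pow₀ (by norm_num))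
  have hb0 : 0 ≤ ((2 : ℝ) ^ e)⁻¹ := by positivity
  have hGeq : ((2 : ℝ) ^ e)⁻¹ ^ (d - 1) = G := by
    rw [hG, hγ, inv_pow, inv_pow, ← pow_mul, ← pow_mul, mul_comm]
  have hρe : ((2 : ℝ) ^ e)⁻¹ ^ d = ρ ^ e := by
    rw [hρ, inv_pow, inv_pow, ← pow_mul, ← pow_mul, mul_comm]
  have hρe1 : ρ ^ e ≤ ρ := by
    calc ρ ^ e ≤ ρ ^ 1 := pow_le_pow_of_le_one hρ0.le hρle he1
      _ = ρ := pow_one ρ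
  have hmain := h' P c hP hc hc6 hc₃' μ hμ U hU hU9 hU₀' β hβmin hβc K hK L M hL3 hM3 d k J' hd hk1 hkJ hJN t p (by omega) (by omega) (Nb t p)
    (hNb0 t p) (hcar t p) Ωe hlev
  set law : ℕ → ℝ := fun p => A * lam ^ (p - 1) * Q ^ p with hlaw
  have hlaw0 : 0 ≤ law p := by positivity
  have hu0 : 0 < klLevUnitF β M t p (d - 1) := klLevUnitF_pos hβ t p (d - 1)
  -- (i) the base term WITHOUT gain
  have hUVt : ((2 : ℝ) ^ e)⁻¹ ^ (J' - (d - 1)) * (Nb t p / klLevUnitF β M t p (d - 1)) ≤ Ab * lam ^ (p - 1) * Qb ^ p := by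
    have hq0 : 0 ≤ Nb t p / klLevUnitF β M t p (d - 1) := div_nonneg (hNb0 t p) hu0.le
    calc ((2 : ℝ) ^ e)⁻¹ ^ (J' - (d - 1)) * (Nb t p / klLevUnitF β M t p (d - 1)) ≤ 1 * (Nb t p / klLevUnitF β M t p (d - 1)) :=
          mul_le_mul_of_nonneg_right (pow_le_one₀ hb0 hb) hq0
      _ ≤ Ab * lam ^ (p - 1) * Qb ^ p := by rw [one_mul]; exact hlawb t p hp
  -- (ii) the born sum with the block gain (only `J′ ≥ dk` is used)
  have hterm : ∀ k' ∈ Ico 1 k, ((2 : ℝ) ^ e)⁻¹ ^ (J' - d * k') * klTowerBLevF L M β U μ K d t (k' + 1) p ≤ G * ρ ^ (k - 1 - k') * law p := by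
    intro k' hk'
    obtain ⟨hk'1, hk'⟩ := mem_Ico.1 hk'
    set n : ℕ := k - 1 - k' with hn
    have hJk : (d - 1) + d * n ≤ J' - d * k' := by
      have h1 : d * k' + d * n + d = d * k := by
        rw [hn, ← Nat.mul_add, ← Nat.mul_succ]; congr 1; omega
      omega
    have hb' : klTowerBLevF L M β U μ K d t (k' + 1) p ≤ law p := hIH (k' + 1) (by omega) (by omega) t p hp hpD
    have hb0' : 0 ≤ klTowerBLevF L M β U μ K d t (k' + 1) p := klTowerBLevF_nonneg hβ U μ K d t (k' + 1) p
    have hrate : ((2 : ℝ) ^ e)⁻¹ ^ (J' - d * k') ≤ G * ρ ^ n := by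
      calc ((2 : ℝ) ^ e)⁻¹ ^ (J' - d * k') ≤ ((2 : ℝ) ^ e)⁻¹ ^ ((d - 1) + d * n) := pow_le_pow_of_le_one hb0 hb hJk
        _ = G * (ρ ^ e) ^ n := by rw [pow_add, hGeq, pow_mul, hρe]
        _ ≤ G * ρ ^ n := mul_le_mul_of_nonneg_left (pow_le_pow_left₀ (by positivity) hρe1 n) hG0
    calc ((2 : ℝ) ^ e)⁻¹ ^ (J' - d * k') * klTowerBLevF L M β U μ K d t (k' + 1) p
        ≤ G * ρ ^ n * klTowerBLevF L M β U μ K d t (k' + 1) p := mul_le_mul_of_nonneg_right hrate hb0'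
      _ ≤ G * ρ ^ n * law p := mul_le_mul_of_nonneg_left hb' (by positivity)
  have hsum : ∑ k' ∈ Ico 1 k, ((2 : ℝ) ^ e)⁻¹ ^ (J' - d * k') * klTowerBLevF L M β U μ K d t (k' + 1) p ≤ G * (law p / (1 - ρ)) := by
    refine (sum_le_sum hterm).trans ?_
    have hsub : Ico 1 k ⊆ range k := fun k' hk' => mem_range.2 (mem_Ico.1 hk').2
    refine (sum_le_sum_of_subset_of_nonneg hsub (fun k' _ _ => by positivity)).trans ?_
    have hre : ∑ k' ∈ range k, G * ρ ^ (k - 1 - k') * law p = G * ((∑ j ∈ range k, ρ ^ j) * law p) := by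
      rw [← sum_range_reflect (fun j => ρ ^ j) k, sum_mul, mul_sum]
      refine sum_congr rfl fun k' _ => ?_
      ring
    rw [hre]
    refine mul_le_mul_of_nonneg_left ?_ hG0
    calc (∑ j ∈ range k, ρ ^ j) * law p ≤ 1 / (1 - ρ) * law p :=
          mul_le_mul_of_nonneg_right (geom_sum_range_le_inv_one_sub hρ0.le hρ1 k) hlaw0
      _ = law p / (1 - ρ) := by rw [one_div, inv_mul_eq_div]
  -- (iii) assemble
  have hpre0 : 0 ≤ (27 : ℝ) ^ ((t : ℕ) + 1) * (C₁ * C₂ ^ (2 * p - 1)) := by positivity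
  have h27 : (27 : ℝ) ^ ((t : ℕ) + 1) ≤ 27 ^ 5 := pow_le_pow_right₀ (by norm_num) (by omega)
  set Mq : ℝ := max Qb (γ * max Q Qb) with hMq
  have hQbM : Qb ≤ Mq := le_max_left _ _
  have hγQ : γ * Q ≤ Mq := (mul_le_mul_of_nonneg_left (le_max_left _ _) hγ0).trans (le_max_right _ _)
  have hMq0 : 0 ≤ Mq := hQb.trans hQbM
  have hC : C₁ * C₂ ^ (2 * p - 1) = C₁ / C₂ * (C₂ ^ 2) ^ p := by
    have hpw : (C₂ ^ 2) ^ p = C₂ ^ (2 * p - 1) * C₂ := by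
      rw [← pow_mul, ← pow_succ]; congr 1; omega
    rw [hpw]
    field_simp
  have hin : Ab * lam ^ (p - 1) * Qb ^ p + G * (law p / (1 - ρ)) ≤ (Ab + (8 : ℝ) ^ (d - 1) * (A / (1 - ρ))) * lam ^ (p - 1) * Mq ^ p := by
    have h1 : Ab * lam ^ (p - 1) * Qb ^ p ≤ Ab * lam ^ (p - 1) * Mq ^ p :=
      mul_le_mul_of_nonneg_left (pow_le_pow_left₀ hQb hQbM p) (by positivity)
    have h2 : G * (law p / (1 - ρ)) ≤ (8 : ℝ) ^ (d - 1) * (A / (1 - ρ)) * lam ^ (p - 1) * Mq ^ p := by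
      have hγQp : γ ^ p * Q ^ p ≤ Mq ^ p := by rw [← mul_pow]; exact pow_le_pow_left₀ (by positivity) hγQ p
      calc G * (law p / (1 - ρ)) ≤ (8 : ℝ) ^ (d - 1) * γ ^ p * (law p / (1 - ρ)) :=
            mul_le_mul_of_nonneg_right hGle (div_nonneg hlaw0 h1ρ.le)
        _ = (8 : ℝ) ^ (d - 1) * (A / (1 - ρ)) * lam ^ (p - 1) * (γ ^ p * Q ^ p) := by
            rw [hlaw]; dsimp only; rw [div_eq_mul_inv, div_eq_mul_inv]; ring
        _ ≤ (8 : ℝ) ^ (d - 1) * (A / (1 - ρ)) * lam ^ (p - 1) * Mq ^ p :=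
            mul_le_mul_of_nonneg_left hγQp (by have : 0 ≤ A / (1 - ρ) := div_nonneg hA h1ρ.le; positivity)
    calc Ab * lam ^ (p - 1) * Qb ^ p + G * (law p / (1 - ρ))
        ≤ Ab * lam ^ (p - 1) * Mq ^ p + (8 : ℝ) ^ (d - 1) * (A / (1 - ρ)) * lam ^ (p - 1) * Mq ^ p := add_le_add h1 h2
      _ = (Ab + (8 : ℝ) ^ (d - 1) * (A / (1 - ρ))) * lam ^ (p - 1) * Mq ^ p := by ring
  have hsum0 : 0 ≤ Ab * lam ^ (p - 1) * Qb ^ p + G * (law p / (1 - ρ)) :=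
    add_nonneg (by positivity) (mul_nonneg hG0 (div_nonneg hlaw0 h1ρ.le))
  calc (27 : ℝ) ^ ((t : ℕ) + 1) * klLevNormOf L M β μ K J' (2 * p) (klTowerInput L M β U μ K d k) Ωe / klLevUnitF β M t p J'
      ≤ (27 : ℝ) ^ ((t : ℕ) + 1) * (C₁ * C₂ ^ (2 * p - 1)) *
          (((2 : ℝ) ^ e)⁻¹ ^ (J' - (d - 1)) * (Nb t p / klLevUnitF β M t p (d - 1)) +
            ∑ k' ∈ Ico 1 k, ((2 : ℝ) ^ e)⁻¹ ^ (J' - d * k') * klTowerBLevF L M β U μ K d t (k' + 1) p) := hmain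
    _ ≤ (27 : ℝ) ^ ((t : ℕ) + 1) * (C₁ * C₂ ^ (2 * p - 1)) * (Ab * lam ^ (p - 1) * Qb ^ p + G * (law p / (1 - ρ))) :=
        mul_le_mul_of_nonneg_left (add_le_add hUVt hsum) hpre0
    _ ≤ (27 : ℝ) ^ 5 * (C₁ * C₂ ^ (2 * p - 1)) * ((Ab + (8 : ℝ) ^ (d - 1) * (A / (1 - ρ))) * lam ^ (p - 1) * Mq ^ p) :=
        mul_le_mul (mul_le_mul_of_nonneg_right h27 (by positivity)) hin hsum0 (by positivity)
    _ = (27 : ℝ) ^ 5 * (C₁ / C₂) * (Ab + (8 : ℝ) ^ (d - 1) * (A / (1 - ρ))) * lam ^ (p - 1) * (C₂ ^ 2 * Mq) ^ p := by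
        rw [hC, mul_pow]; ring

end Summit.HubbardSuperconductivity.HubbardSuperconductivity.Theorems.EngineV8

end
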